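import Mathlib
import HarnessLib
import Summits.CriticalPhenomena.CardyFormulaZ2.Theses.CardySelfDualSegment
import Literature.Probability.Percolation.CornerPercolation
import Summits.CriticalPhenomena.CardyFormulaZ2.Theorems.CardySelfDualSegmentSegmentOpenStubCrossingProbPolynomial
import Summits.CriticalPhenomena.CardyFormulaZ2.Theorems.CardySelfDualSegmentSegmentOpenStubGoodSetNhdsZeroOfJets

/-!
# Crux `SegmentOpen` (stmt-CriticalPhenomena-5471), line `Sketch` — census: crossing limits from jet convergence

Lead c4, companion of the glue stub GZ (`stub_goodSetNhdsZero_of_jets`, p132942).  The Smirnov-jet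
stub SJ of reshape 6 has two halves: (JetConv) the coefficients of the crossing polynomials
`p_δ(t) = P_t(R', δ)` converge as `δ → 0⁺`; (Ident) the perturbation series sums to the Cardy value
of the `α(t)`-sheared rectangle.  Here: under VJ (Vitali with jets, landed p132875) and S4s
(uniform complex bound at small mesh — hypothesis, NOT claimed), JetConv ALONE gives the EXISTENCE of
the scaling limits `lim_{δ→0⁺} P_t(R', δ) = Σ_k a_k(R') t^k` for every `R'` and every `t < r`, the
S4s radius at `t₀ = 0` (`crossingLimit_of_jetConv`).  So SJ = JetConv ∧ linear identification of
these analytic limit functions.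
-/

noncomputable section

namespace Summit.CriticalPhenomena.CardyFormulaZ2.Theorems

open Literature.Probability Literature.Barriers.CriticalPhenomena
open Literature.Probability.RandomPlanarGeometry (ConformalRectangle ConformalEquiv MarkedDomain)
open Filter Set Topology MeasureTheory
open UpperHalfPlane (upperHalfPlaneSet)

namespace GoodSetNhdsZeroOfJets

/-- **Convergence along one sequence of meshes, without identification.**  As
`tendsto_eval_of_jets`, but with no a-priori value of the perturbation series: VJ, the uniform bound
on `B(0, r)` and the convergence of the coefficients give, at every real `0 ≤ s < r`, a sum `L` of
`Σ a k s^k` to which the evaluations `(P (d n)).eval s` converge along every `d n → 0⁺`. -/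
theorem exists_hasSum_tendsto_eval_of_jetConv
    (hVJ : ∀ (U : Set ℂ), IsOpen U → IsPreconnected U → ∀ z₀ ∈ U, ∀ (F : ℕ → ℂ → ℂ) (c : ℕ → ℂ),
      (∀ n, DifferentiableOn ℂ (F n) U) →
      (∀ a ∈ U, ∃ M : ℝ, ∃ r > 0, ∀ n, ∀ z ∈ Metric.ball a r ∩ U, ‖F n z‖ ≤ M) →
      (∀ k : ℕ, Tendsto (fun n => iteratedDeriv k (F n) z₀) atTop (𝓝 (c k))) →
      ∃ f : ℂ → ℂ, DifferentiableOn ℂ f U ∧ TendstoLocallyUniformlyOn F f atTop U ∧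
        ∀ k : ℕ, iteratedDeriv k f z₀ = c k)
    {r δ₁ C : ℝ} (hr : 0 < r) (hδ₁ : 0 < δ₁) (P : ℝ → Polynomial ℝ)
    (hC : ∀ δ : ℝ, 0 < δ → δ < δ₁ →
      ∀ z ∈ Metric.ball (0 : ℂ) r, ‖((P δ).map (algebraMap ℝ ℂ)).eval z‖ ≤ C)
    {a : ℕ → ℝ}
    (ha : ∀ k : ℕ, ∀ ε > 0, ∃ δ₀ > 0, ∀ δ : ℝ, 0 < δ → δ < δ₀ → |(P δ).coeff k - a k| < ε)
    {s : ℝ} (hs0 : 0 ≤ s) (hsr : s < r)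
    {d : ℕ → ℝ} (hd : Tendsto d atTop (𝓝[>] 0)) :
    ∃ L : ℝ, HasSum (fun k : ℕ => a k * s ^ k) L ∧
      Tendsto (fun n => (P (d n)).eval s) atTop (𝓝 L) := by
  classical
  -- admissible meshes, eventually all of them
  have hgood : ∀ᶠ n in atTop, 0 < d n ∧ d n < δ₁ := by
    have h1 : ∀ᶠ n in atTop, d n ∈ Ioo 0 δ₁ := hd (Ioo_mem_nhdsGT hδ₁)
    exact h1.mono fun n hn => hn
  -- the holomorphic sequence on the disc
  set U : Set ℂ := Metric.ball (0 : ℂ) r with hU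
  set F : ℕ → ℂ → ℂ := fun n =>
    if 0 < d n ∧ d n < δ₁ then fun z => ((P (d n)).map (algebraMap ℝ ℂ)).eval z else 0 with hF
  have hFgood : ∀ n, 0 < d n ∧ d n < δ₁ →
      F n = fun z => ((P (d n)).map (algebraMap ℝ ℂ)).eval z := fun n hn => by
    simp only [hF, if_pos hn]
  have hFbad : ∀ n, ¬ (0 < d n ∧ d n < δ₁) → F n = 0 := fun n hn => by
    simp only [hF, if_neg hn]
  have hUo : IsOpen U := Metric.isOpen_ball
  have hUc : IsPreconnected U := (convex_ball (0 : ℂ) r).isPreconnected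
  have h0U : (0 : ℂ) ∈ U := Metric.mem_ball_self hr
  have hFd : ∀ n, DifferentiableOn ℂ (F n) U := fun n => by
    by_cases hn : 0 < d n ∧ d n < δ₁
    · rw [hFgood n hn]
      exact (Polynomial.differentiable _).differentiableOn
    · rw [hFbad n hn]
      exact differentiableOn_const 0
  have hFb : ∀ w ∈ U, ∃ M : ℝ, ∃ ρ > 0, ∀ n, ∀ z ∈ Metric.ball w ρ ∩ U, ‖F n z‖ ≤ M := by
    intro w _
    refine ⟨max C 0, 1, one_pos, fun n z hz => ?_⟩
    by_cases hn : 0 < d n ∧ d n < δ₁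
    · rw [hFgood n hn]
      exact (hC (d n) hn.1 hn.2 z hz.2).trans (le_max_left _ _)
    · rw [hFbad n hn]
      simp
  -- the jets at `0` converge to `k! · a k`
  have hcoeff : ∀ k : ℕ, Tendsto (fun n => (P (d n)).coeff k) atTop (𝓝 (a k)) := by
    intro k
    rw [Metric.tendsto_nhds]
    intro ε hε
    obtain ⟨δ₀, hδ₀, hδ⟩ := ha k ε hε
    have h1 : ∀ᶠ n in atTop, d n ∈ Ioo 0 δ₀ := hd (Ioo_mem_nhdsGT hδ₀)
    exact h1.mono fun n hn => hδ (d n) hn.1 hn.2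
  have hjet : ∀ k : ℕ, Tendsto (fun n => iteratedDeriv k (F n) 0) atTop
      (𝓝 ((k.factorial : ℂ) * ((a k : ℝ) : ℂ))) := by
    intro k
    have h1 : Tendsto (fun n => (k.factorial : ℂ) * (((P (d n)).coeff k : ℝ) : ℂ)) atTop
        (𝓝 ((k.factorial : ℂ) * ((a k : ℝ) : ℂ))) :=
      ((Complex.continuous_ofReal.tendsto (a k)).comp (hcoeff k)).const_mul _
    refine h1.congr' ?_
    filter_upwards [hgood] with n hn
    rw [hFgood n hn, iteratedDeriv_map_eval_zero]
  -- Vitali with jets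
  obtain ⟨g, hgd, hgF, hgjet⟩ := hVJ U hUo hUc 0 h0U F _ hFd hFb hjet
  -- Taylor expansion of the limit at `0`, evaluated at `s`: the perturbation series sums to `g s`
  have hsU : (s : ℂ) ∈ U := by
    rw [hU, Metric.mem_ball, dist_zero_right, Complex.norm_real, Real.norm_eq_abs,
      abs_of_nonneg hs0]
    exact hsr
  have hT := Complex.hasSum_taylorSeries_on_ball hgd hsU
  have hfun : (fun n : ℕ => (n.factorial : ℂ)⁻¹ • ((s : ℂ) - 0) ^ n • iteratedDeriv n g 0) =
      fun k : ℕ => (((a k * s ^ k : ℝ)) : ℂ) := by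
    funext k
    rw [hgjet k, sub_zero, smul_eq_mul, smul_eq_mul]
    have hk : (k.factorial : ℂ) ≠ 0 := by exact_mod_cast Nat.factorial_ne_zero k
    push_cast
    field_simp
  rw [hfun] at hT
  -- its real part: the real perturbation series sums to `re (g s)`
  have hTre := Complex.reCLM.hasSum hT
  have hLre : HasSum (fun k : ℕ => a k * s ^ k) (g s).re := by
    refine hTre.congr_fun fun k => ?_
    simp only [Complex.reCLM_apply, Complex.ofReal_re]
  refine ⟨(g s).re, hLre, ?_⟩
  -- pointwise convergence at `s`
  have hpt : Tendsto (fun n => F n s) atTop (𝓝 (g s)) := hgF.tendsto_at hsU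
  have hpt' : Tendsto (fun n => (((P (d n)).eval s : ℝ) : ℂ)) atTop (𝓝 (g s)) := by
    refine hpt.congr' ?_
    filter_upwards [hgood] with n hn
    rw [hFgood n hn]
    -- a real polynomial mapped to `ℂ`, evaluated at a real point, is the real evaluation
    change ((P (d n)).map (algebraMap ℝ ℂ)).eval (algebraMap ℝ ℂ s) =
      algebraMap ℝ ℂ ((P (d n)).eval s)
    rw [Polynomial.eval_map, Polynomial.eval₂_at_apply]
  have hre := (Complex.continuous_re.tendsto (g s)).comp hpt'
  exact hre.congr fun n => by simp

end GoodSetNhdsZeroOfJets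

open GoodSetNhdsZeroOfJets in
/-- **Census (lead c4): under VJ and S4s, convergence of the Smirnov-point jets ALONE gives the
EXISTENCE of the crossing limits of `M_t` near `t = 0`, analytic in `t`.**  Assume VJ and S4s
(hypotheses, verbatim the registered stubs).  Then there is `r > 0` (the S4s radius at `t₀ = 0`,
uniform in the rectangle) such that for every conformal rectangle `R'` and every sequence
`a : ℕ → ℝ` of limits of the coefficients of its crossing polynomials (the JetConv half of
`stub_smirnovJet`), for every `t ∈ [0,1]` with `t < r` the perturbation series `Σ_k a k t^k` is
summable and the crude `M_t`-crossing probabilities of `R'` CONVERGE as the mesh `δ → 0⁺`, to its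
sum.  Hence SJ = JetConv ∧ (linear identification: `Σ_k a_k(R') t^k = F(M_{R'}(α t))`), and JetConv
∧ S4s alone already settle the existence of scaling limits of crossing probabilities for the corner
models `M_t`, `t < r`. -/
theorem crossingLimit_of_jetConv :
    (∀ (U : Set ℂ), IsOpen U → IsPreconnected U → ∀ z₀ ∈ U, ∀ (F : ℕ → ℂ → ℂ) (c : ℕ → ℂ),
      (∀ n, DifferentiableOn ℂ (F n) U) →
      (∀ a ∈ U, ∃ M : ℝ, ∃ r > 0, ∀ n, ∀ z ∈ Metric.ball a r ∩ U, ‖F n z‖ ≤ M) →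
      (∀ k : ℕ, Tendsto (fun n => iteratedDeriv k (F n) z₀) atTop (𝓝 (c k))) →
      ∃ f : ℂ → ℂ, DifferentiableOn ℂ f U ∧ TendstoLocallyUniformlyOn F f atTop U ∧
        ∀ k : ℕ, iteratedDeriv k f z₀ = c k) →
    (∀ t₀ : unitInterval, ∃ r > 0, ∀ R : ConformalRectangle, ∃ δ₁ > 0, ∃ C : ℝ, ∀ δ : ℝ,
      0 < δ → δ < δ₁ → ∀ p : Polynomial ℝ,
        (∀ t : unitInterval, Percolation.cornerCrossingProb t R δ = p.eval (t : ℝ)) →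
        ∀ z ∈ Metric.ball ((t₀ : ℝ) : ℂ) r, ‖(p.map (algebraMap ℝ ℂ)).eval z‖ ≤ C) →
    ∃ r > 0, ∀ (R' : ConformalRectangle) (a : ℕ → ℝ),
      (∀ k : ℕ, ∀ ε > 0, ∃ δ₀ > 0, ∀ δ : ℝ, 0 < δ → δ < δ₀ → ∀ p : Polynomial ℝ,
          (∀ t : unitInterval, Percolation.cornerCrossingProb t R' δ = p.eval (t : ℝ)) →
          |p.coeff k - a k| < ε) →
      ∀ t : unitInterval, (t : ℝ) < r →
        Summable (fun k : ℕ => a k * (t : ℝ) ^ k) ∧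
        Tendsto (Percolation.cornerCrossingProb t R') (𝓝[>] 0)
          (𝓝 (∑' k : ℕ, a k * (t : ℝ) ^ k)) := by
  classical
  intro hVJ h4
  obtain ⟨r, hr, hR⟩ := h4 0
  refine ⟨r, hr, fun R' a hconv t htr => ?_⟩
  -- the uniform bound at `t₀ = 0` for `R'` (S4s), crossing polynomials from S1
  obtain ⟨δ₁, hδ₁, C, hC⟩ := hR R'
  have h00 : (((0 : unitInterval) : ℝ) : ℂ) = 0 := by simp
  rw [h00] at hC
  set P : ℝ → Polynomial ℝ := fun δ =>
    if h : 0 < δ then Classical.choose (stub_crossingProbPolynomial R' δ h) else 0 with hP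
  have hPspec : ∀ δ : ℝ, 0 < δ → ∀ s : unitInterval,
      Percolation.cornerCrossingProb s R' δ = (P δ).eval (s : ℝ) := fun δ hδ => by
    simp only [hP, dif_pos hδ]
    exact Classical.choose_spec (stub_crossingProbPolynomial R' δ hδ)
  have hCP : ∀ δ : ℝ, 0 < δ → δ < δ₁ →
      ∀ z ∈ Metric.ball (0 : ℂ) r, ‖((P δ).map (algebraMap ℝ ℂ)).eval z‖ ≤ C :=
    fun δ hδ hδ' z hz => hC δ hδ hδ' (P δ) (hPspec δ hδ) z hz
  have haP : ∀ k : ℕ, ∀ ε > 0, ∃ δ₀ > 0, ∀ δ : ℝ, 0 < δ → δ < δ₀ → |(P δ).coeff k - a k| < ε :=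
    fun k ε hε => by
      obtain ⟨δ₀, hδ₀, h⟩ := hconv k ε hε
      exact ⟨δ₀, hδ₀, fun δ hδ hδ' => h δ hδ hδ' (P δ) (hPspec δ hδ)⟩
  -- summability, from the constant sequence of meshes `d n = 1/(n+2)` (any sequence would do)
  have hd0 : Tendsto (fun n : ℕ => (1 : ℝ) / ((n : ℝ) + 2)) atTop (𝓝[>] 0) := by
    refine tendsto_nhdsWithin_iff.2 ⟨?_, Eventually.of_forall fun n => ?_⟩
    · have h1 : Tendsto (fun n : ℕ => (n : ℝ) + 2) atTop atTop :=
        tendsto_natCast_atTop_atTop.atTop_add tendsto_const_nhds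
      exact h1.const_div_atTop 1
    · show (1 : ℝ) / ((n : ℝ) + 2) ∈ Ioi 0
      exact mem_Ioi.2 (by positivity)
  obtain ⟨L, hL, -⟩ := exists_hasSum_tendsto_eval_of_jetConv hVJ hr hδ₁ P hCP haP
    (unitInterval.nonneg t) htr hd0
  refine ⟨hL.summable, ?_⟩
  rw [hL.tsum_eq]
  -- convergence along every sequence of meshes
  rw [tendsto_iff_seq_tendsto]
  intro d hd
  obtain ⟨L', hL', key⟩ := exists_hasSum_tendsto_eval_of_jetConv hVJ hr hδ₁ P hCP haP
    (unitInterval.nonneg t) htr hd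
  have hLL : L' = L := hL'.unique hL
  rw [hLL] at key
  have hgood : ∀ᶠ n in atTop, 0 < d n := by
    have h1 : ∀ᶠ n in atTop, d n ∈ Ioi 0 := hd self_mem_nhdsWithin
    exact h1.mono fun n hn => hn
  refine key.congr' ?_
  filter_upwards [hgood] with n hn
  exact (hPspec (d n) hn t).symm

end Summit.CriticalPhenomena.CardyFormulaZ2.Theorems
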